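import Mathlib
import HarnessLib.Audit
import Summits.PneNP.PneNP.Theorems.PstarDeadPatterns
import Summits.PneNP.PneNP.Theorems.PstarSharedMemberKill

/-!
# The member kills in JOIN FORM: frozen-or-thawed is a combinatorial condition (ROUND-24, O1; memo g28 §76)

FRONTIER range-avoidance ladder, rung F-N3, ROUND 24 (cell `pnp-ideate`, prover-2 memo `g28/O1-JOINS-g28.md` §76; census node
`PstarLocalGateBudgetAssembly.LocalMenuCriterionBoundGateBudget`; restricted-model proof complexity — nothing here bears on `P` versus `NP`).

`PstarDirtyMemberSquare.not_terminal_of_dirty_member` and `PstarSharedMemberKill.not_terminal_of_shared_member` kill a candidate certificate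
`(K; Γ₁, Γ₂)` at a member `e` under two SEMANTIC side conditions, quantified over all assignments: the idle set (`A₀ = A ∩ {x_p x_{p'} = 0}`,
resp. `A₁ = A ∩ {x_σ = 0}`) is non-empty, and every `Γ₂`-gate partner `u` of the member's block is FROZEN on the big slice
`Ā = Sol(K ∖ e) ∩ {Γ₁ = b₁}` or THAWED in the idle set.  This file replaces both by JOIN ENUMERATIONS over `K` (memo g27 §72.3 / §73, the
announced discharge), so that a census decides the kills by listing the joins of `K` for `C₁` — on a cycle core: `∅`, the cycle, and the two
arcs-with-folds — and nothing else:

* `inSliceBut_iff_erase` — `Ā` is the slice of `K ∖ e`;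
* **`frozen_of_block_join`** — a one-block value-`1` join through `u` INSIDE `K ∖ e` (folds through `u` if it uses the reader) pins `x_u ≡ 1` on
  `Ā` (`PstarLiteralPinning.true_of_block_join` on `K ∖ e`), so `u` is frozen;
* **`inSlice_update_of_dead_partners`** — if `u ∉ C₁` is no XOR variable of `K` and every output of `K ∪ G₁` through `u` has its other AND variable
  at `0`, then `x_u` is FREE: every update of `u` stays in the slice (pure instances; no privacy needed);
* **`thawed_of_no_dead_join`** — hence, for a dead pattern `Z ∋ v` containing the `K ∪ G₁`-partners of `u` with no dead join of value `1`
  (`PstarDeadPatterns.exists_zero_on_of_no_dead_join`), `u` is thawed in `A ∩ {x_v = 0}`;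
* **`not_terminal_of_dirty_member_joins`**, **`not_terminal_of_shared_member_joins`** — the two kills with `A₀ ≠ ∅` / `A₁ ≠ ∅` and
  frozen-or-thawed replaced by: the pattern `{p}` (resp. `{σ}`) has no dead value-`1` join, and every gate partner `u` carries EITHER a one-block
  value-`1` join inside `K ∖ e` OR an admissible thaw pattern with no dead value-`1` join.  Hypotheses otherwise as in the semantic versions plus
  typedness, `C₁` off the AND variables of `K ∪ G₁`, and PRIVACY (every output of `K ∪ G₁` has an AND variable in no other AND slot of `K ∪ G₁`);
* `not_terminal_of_untouched_dirty_joins`, `not_terminal_of_untouched_shared_joins` — the «`Γ₂` touches every defect» corollaries likewise.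

READING (all `k`).  In the planners' structures the thaw pattern of a partner `u` is `{v} ∪ N(u)` with `N(p_i) = {σ_i}`, `N(σ_i) = {p_i, q_i}`,
`N(π_d) = {π_d'}`, `N(fresh) = ∅`: its dead outputs are `e` together with `u`'s BLOCK.  On a cycle core the only joins are the cycle (`t = 0`) and
the two arcs completed by all folds (`t = 1`); a dead value-`1` join therefore needs an arc-with-folds inside «`e`'s block ∪ `u`'s block», which is
impossible as soon as `e`'s arc carries two further blocks and the other arc is not a single block of value `1` (then `u` is pinned, the first
disjunct).  This is the formal content of «three-block arcs certify nothing» (p3 memo r24 §14.63), now decided by join lists alone.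
-/

set_option linter.dupNamespace false -- `Summit.PneNP.PneNP.…`: summit = sub-problem name (D-0017 single-conjunct layout)

open Finset Literature.Computability.Complexity
open Summit.PneNP.PneNP.Theorems.PstarFibrePolys (bit bit_xor bit_and bit_injective)
open Summit.PneNP.PneNP.Theorems.PstarTyped (Typed)
open Summit.PneNP.PneNP.Theorems.PstarSALevel (varSet)
open Summit.PneNP.PneNP.Theorems.PstarGapPeeling (eval_pure)
open Summit.PneNP.PneNP.Theorems.PstarGapOneAll (gval)
open Summit.PneNP.PneNP.Theorems.PstarGConstraint (bit_gval)
open Summit.PneNP.PneNP.Theorems.PstarCoreBoundTargets (Terminal)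
open Summit.PneNP.PneNP.Theorems.PstarLiteralPinning (Through InSlice IsJoin joinValue true_of_block_join)
open Summit.PneNP.PneNP.Theorems.PstarDeadPatterns (Dead exists_zero_on_of_no_dead_join)
open Summit.PneNP.PneNP.Theorems.PstarDirtyMemberSquare (InSliceBut inSlice_iff not_terminal_of_dirty_member not_terminal_of_untouched_dirty)
open Summit.PneNP.PneNP.Theorems.PstarSharedMemberSquare (Setup)
open Summit.PneNP.PneNP.Theorems.PstarSharedMemberKill (not_terminal_of_shared_member not_terminal_of_untouched_shared)

namespace Summit.PneNP.PneNP.Theorems.PstarMemberKillJoins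

variable {n m : ℕ} {I : LocalMap 4 n m} {y : Fin m → Bool} {K : Finset (Fin m)} {w₁ w₂ : Finset (Fin n) × Finset (Fin m) × Bool}

/-! ## Small facts -/

/-- Every slot variable of an output lies in its variable set. -/
private theorem vars_mem_varSet (I : LocalMap 4 n m) (j : Fin m) (s : Fin 4) : I.vars j s ∈ varSet I j := by
  unfold PstarSALevel.varSet; exact mem_image_of_mem _ (mem_univ s)

/-- A singleton pattern kills exactly the outputs through its variable. -/
theorem dead_singleton_iff {v : Fin n} {j : Fin m} : Dead I ({v} : Finset (Fin n)) j ↔ Through I v j :=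
  ⟨fun ⟨w, hw, hwj⟩ => by rw [mem_singleton] at hw; exact hw ▸ hwj, fun h => ⟨v, mem_singleton_self v, h⟩⟩

/-- **The big slice `Ā = Sol(K ∖ e) ∩ {Γ₁ = b₁}` is the slice of the family `K ∖ e`.** -/
theorem inSliceBut_iff_erase {e : Fin m} {z : Fin n → Bool} : InSliceBut I y K e w₁ z ↔ InSlice I y (K.erase e) w₁ z :=
  ⟨fun h => ⟨fun j hj => h.1 j (mem_of_mem_erase hj) (ne_of_mem_erase hj), h.2⟩,
    fun h => ⟨fun j hj hje => h.1 j (mem_erase.2 ⟨hje, hj⟩), h.2⟩⟩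

/-! ## FROZEN: a one-block value-one join through `u` inside `K ∖ e` -/

/-- **A one-block value-`1` join through `u` inside `K ∖ e` pins `x_u ≡ 1` on the big slice `Ā`.**  (`true_of_block_join` for the family `K ∖ e`:
sum the equations of the join; pure instance, nothing else.) -/
theorem true_on_sliceBut_of_block_join (hI : I.IsPure xorAndPred) {e : Fin m} {u : Fin n} {D : Finset (Fin m)} {t : Bool}
    (hD : D ⊆ K.erase e) (hJ : IsJoin I w₁.1 D t) (hDu : ∀ j ∈ D, Through I u j) (hGu : t = true → ∀ g ∈ w₁.2.1, Through I u g)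
    (hval : joinValue y w₁.2.2 D t = 1) {q : Fin n → Bool} (hq : InSliceBut I y K e w₁ q) : q u = true :=
  true_of_block_join hI hD hJ hDu hGu hval (inSliceBut_iff_erase.1 hq)

/-- **FROZEN.**  Under the same hypotheses `x_u` takes one value on all of `Ā`. -/
theorem frozen_of_block_join (hI : I.IsPure xorAndPred) {e : Fin m} {u : Fin n} {D : Finset (Fin m)} {t : Bool}
    (hD : D ⊆ K.erase e) (hJ : IsJoin I w₁.1 D t) (hDu : ∀ j ∈ D, Through I u j) (hGu : t = true → ∀ g ∈ w₁.2.1, Through I u g)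
    (hval : joinValue y w₁.2.2 D t = 1) (q q' : Fin n → Bool) (hq : InSliceBut I y K e w₁ q) (hq' : InSliceBut I y K e w₁ q') :
    q u = q' u := by
  rw [true_on_sliceBut_of_block_join hI hD hJ hDu hGu hval hq, true_on_sliceBut_of_block_join hI hD hJ hDu hGu hval hq']

/-! ## THAWED: dead partners free the variable -/

/-- **FREE FLIP.**  Pure instance; `z` in the slice of `(K; Γ₁)`; `u ∉ C₁`; `u` in no XOR slot of `K`; every output of `K ∪ G₁` through `u` has its
OTHER AND variable at `0` in `z`.  Then every update of `x_u` stays in the slice (no term moves, no XOR part or linear read sees `u`). -/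
theorem inSlice_update_of_dead_partners (hI : I.IsPure xorAndPred) {u : Fin n} {z : Fin n → Bool} (hz : InSlice I y K w₁ z)
    (huC : u ∉ w₁.1) (huX : ∀ j ∈ K, I.vars j 0 ≠ u ∧ I.vars j 1 ≠ u)
    (hdead : ∀ j ∈ K ∪ w₁.2.1, (I.vars j 2 = u → z (I.vars j 3) = false) ∧ (I.vars j 3 = u → z (I.vars j 2) = false)) (b : Bool) :
    InSlice I y K w₁ (Function.update z u b) := by
  -- a term through `u` has a dead partner and stays `0`; the other terms do not see `u`
  have hterm : ∀ j ∈ K ∪ w₁.2.1, bit (Function.update z u b (I.vars j 2)) * bit (Function.update z u b (I.vars j 3)) =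
      bit (z (I.vars j 2)) * bit (z (I.vars j 3)) := by
    intro j hj
    have h23 : I.vars j 2 ≠ I.vars j 3 := fun h => absurd (hI.2 j h) (by decide)
    by_cases h2 : I.vars j 2 = u
    · have h3 : I.vars j 3 ≠ u := fun h => h23 (h2.trans h.symm)
      rw [Function.update_of_ne h3, (hdead j hj).1 h2]
      simp [bit]
    · by_cases h3 : I.vars j 3 = u
      · rw [Function.update_of_ne h2, (hdead j hj).2 h3]
        simp [bit]
      · rw [Function.update_of_ne h2, Function.update_of_ne h3]
  refine ⟨fun j hj => ?_, ?_⟩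
  · rw [← hz.1 j hj]
    apply bit_injective
    simp only [eval_pure I hI, bit_xor, bit_and]
    rw [Function.update_of_ne (huX j hj).1, Function.update_of_ne (huX j hj).2, hterm j (mem_union_left _ hj)]
  · rw [← hz.2]
    apply bit_injective
    rw [bit_gval, bit_gval]
    congr 1
    · exact sum_congr rfl fun w hw => by rw [Function.update_of_ne (ne_of_mem_of_not_mem hw huC)]
    · exact sum_congr rfl fun g hg => hterm g (mem_union_right _ hg)

/-- **THAWED BY A FEASIBLE PATTERN.**  Typed pure instance, `K ∩ G₁ = ∅`, `C₁` off the AND variables of `K ∪ G₁`; a dead pattern `Z` off the XOR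
slots of `K` and off `C₁`, PRIVACY for the live outputs, and NO DEAD JOIN OF VALUE `1` for `Z`.  If `Z ∋ v` contains every `K ∪ G₁`-partner of a
variable `u ∉ C₁` that is no XOR variable of `K`, then `u` is THAWED in `A ∩ {x_v = 0}`: some `z` of the slice with `z v = 0` keeps `z ⊕ e_u` in the
slice. -/
theorem thawed_of_no_dead_join [Nonempty (Fin n)] (hI : I.IsPure xorAndPred) (hT : Typed I) (hKG : Disjoint K w₁.2.1)
    (hC₁ : ∀ v ∈ w₁.1, ∀ j ∈ K ∪ w₁.2.1, ¬ Through I v j) {Z : Finset (Fin n)}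
    (hZX : ∀ v ∈ Z, ∀ j ∈ K, I.vars j 0 ≠ v ∧ I.vars j 1 ≠ v) (hZC : ∀ v ∈ Z, v ∉ w₁.1)
    (hfree : ∀ j ∈ K ∪ w₁.2.1, ¬ Dead I Z j → ∃ a, Through I a j ∧ ∀ j' ∈ K ∪ w₁.2.1, Through I a j' → j' = j)
    (hno : ∀ D ⊆ K, ∀ t : Bool, IsJoin I w₁.1 D t → (∀ j ∈ D, Dead I Z j) → (t = true → ∀ g ∈ w₁.2.1, Dead I Z g) →
      joinValue y w₁.2.2 D t ≠ 1)
    {u v : Fin n} (hvZ : v ∈ Z) (huZ : ∀ j ∈ K ∪ w₁.2.1, (I.vars j 2 = u → I.vars j 3 ∈ Z) ∧ (I.vars j 3 = u → I.vars j 2 ∈ Z))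
    (huC : u ∉ w₁.1) (huX : ∀ j ∈ K, I.vars j 0 ≠ u ∧ I.vars j 1 ≠ u) :
    ∃ z, (InSlice I y K w₁ z ∧ z v = false) ∧ InSlice I y K w₁ (Function.update z u (!z u)) := by
  obtain ⟨z, hz, hzZ⟩ := exists_zero_on_of_no_dead_join hI hT hKG hC₁ hZX hZC hfree hno
  exact ⟨z, ⟨hz, hzZ v hvZ⟩, inSlice_update_of_dead_partners hI hz huC huX
    (fun j hj => ⟨fun h2 => hzZ _ ((huZ j hj).1 h2), fun h3 => hzZ _ ((huZ j hj).2 h3)⟩) _⟩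

/-- **IDLE POINT BY A FEASIBLE SINGLETON PATTERN.**  With `Z = {v}`: if no join all of whose members (and folds, if it uses the reader) pass through
`v` has value `1`, the slice has a point with `x_v = 0`. -/
theorem exists_false_of_no_dead_join_singleton [Nonempty (Fin n)] (hI : I.IsPure xorAndPred) (hT : Typed I) (hKG : Disjoint K w₁.2.1)
    (hC₁ : ∀ v ∈ w₁.1, ∀ j ∈ K ∪ w₁.2.1, ¬ Through I v j) {v : Fin n}
    (hvX : ∀ j ∈ K, I.vars j 0 ≠ v ∧ I.vars j 1 ≠ v) (hvC : v ∉ w₁.1)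
    (hfree : ∀ j ∈ K ∪ w₁.2.1, ¬ Through I v j → ∃ a, Through I a j ∧ ∀ j' ∈ K ∪ w₁.2.1, Through I a j' → j' = j)
    (hno : ∀ D ⊆ K, ∀ t : Bool, IsJoin I w₁.1 D t → (∀ j ∈ D, Through I v j) → (t = true → ∀ g ∈ w₁.2.1, Through I v g) →
      joinValue y w₁.2.2 D t ≠ 1) :
    ∃ z, InSlice I y K w₁ z ∧ z v = false := by
  have hZX : ∀ w ∈ ({v} : Finset (Fin n)), ∀ j ∈ K, I.vars j 0 ≠ w ∧ I.vars j 1 ≠ w := fun w hw => by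
    rw [mem_singleton] at hw; subst hw; exact hvX
  have hZC : ∀ w ∈ ({v} : Finset (Fin n)), w ∉ w₁.1 := fun w hw => by rw [mem_singleton] at hw; subst hw; exact hvC
  obtain ⟨z, hz, hzZ⟩ := exists_zero_on_of_no_dead_join hI hT hKG hC₁ hZX hZC
    (fun j hj hd => hfree j hj fun h => hd (dead_singleton_iff.2 h))
    (fun D hD t hJ hDs hGs => hno D hD t hJ (fun j hj => dead_singleton_iff.1 (hDs j hj))
      fun ht g hg => dead_singleton_iff.1 (hGs ht g hg))
  exact ⟨z, hz, hzZ v (mem_singleton_self v)⟩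

/-! ## The dirty-member kill in join form -/

section Dirty

variable {r : ℕ} {e : Fin m} {p p' : Fin n}

/-- **A DIRTY MEMBER KILLS THE CERTIFICATE — JOIN FORM.**  Typed pure instance; `e ∈ K` dirty with AND variables `p, p'` (private: in no other
output of `K`, not read by `Γ₁`, in no monomial of `Γ₁`, no XOR variable of `e`); `K ∩ G₁ = ∅`; `C₁` off the AND variables of `K ∪ G₁`; PRIVACY for
`K ∪ G₁`; simple overlaps among the monomials of `Γ₂` and no `Γ₂`-gate `{p, p'}`.  JOIN HYPOTHESES: (idle) no join whose members — and folds, if it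
uses the reader — all pass through `p` has value `1`; (partners) every `Γ₂`-gate partner `u` of `p` or `p'` carries EITHER a one-block value-`1`
join through `u` inside `K ∖ e` OR (`u ∉ C₁`, `u` no XOR variable of `K`) a pattern `Z ∋ v` (`v` its mate among `p, p'`) containing every
`K ∪ G₁`-partner of `u`, off the XOR slots of `K` and off `C₁`, with no dead join of value `1`.  Then `(K; Γ₁, Γ₂)` is not terminal. -/
theorem not_terminal_of_dirty_member_joins (hI : I.IsPure xorAndPred) (hT : Typed I) (he : e ∈ K) (hKG : Disjoint K w₁.2.1)
    (hslots : I.vars e 2 = p ∧ I.vars e 3 = p') (hpe : I.vars e 0 ≠ p ∧ I.vars e 1 ≠ p ∧ I.vars e 0 ≠ p' ∧ I.vars e 1 ≠ p')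
    (hpK : ∀ j ∈ K, j ≠ e → p ∉ varSet I j ∧ p' ∉ varSet I j) (hpC₁ : p ∉ w₁.1 ∧ p' ∉ w₁.1)
    (hpG₁ : ∀ g ∈ w₁.2.1, (I.vars g 2 ≠ p ∧ I.vars g 3 ≠ p) ∧ (I.vars g 2 ≠ p' ∧ I.vars g 3 ≠ p'))
    (hpp' : ∀ g ∈ w₂.2.1, ¬ ((I.vars g 2 = p ∧ I.vars g 3 = p') ∨ (I.vars g 2 = p' ∧ I.vars g 3 = p)))
    (hSG : ∀ g ∈ w₂.2.1, ∀ g' ∈ w₂.2.1, g' ≠ g → ¬ ((I.vars g' 2 = I.vars g 2 ∧ I.vars g' 3 = I.vars g 3) ∨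
      (I.vars g' 2 = I.vars g 3 ∧ I.vars g' 3 = I.vars g 2)))
    (hC₁ : ∀ v ∈ w₁.1, ∀ j ∈ K ∪ w₁.2.1, ¬ Through I v j)
    (hpriv : ∀ j ∈ K ∪ w₁.2.1, ∃ a, Through I a j ∧ ∀ j' ∈ K ∪ w₁.2.1, Through I a j' → j' = j)
    (hidle : ∀ D ⊆ K, ∀ t : Bool, IsJoin I w₁.1 D t → (∀ j ∈ D, Through I p j) → (t = true → ∀ g ∈ w₁.2.1, Through I p g) →
      joinValue y w₁.2.2 D t ≠ 1)
    (hpart : ∀ g ∈ w₂.2.1, ∀ u v : Fin n, (v = p ∨ v = p') → ((I.vars g 2 = v ∧ I.vars g 3 = u) ∨ (I.vars g 2 = u ∧ I.vars g 3 = v)) →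
      (∃ D ⊆ K.erase e, ∃ t : Bool, IsJoin I w₁.1 D t ∧ (∀ j ∈ D, Through I u j) ∧ (t = true → ∀ g' ∈ w₁.2.1, Through I u g') ∧
          joinValue y w₁.2.2 D t = 1) ∨
      (u ∉ w₁.1 ∧ (∀ j ∈ K, I.vars j 0 ≠ u ∧ I.vars j 1 ≠ u) ∧
        ∃ Z : Finset (Fin n), v ∈ Z ∧ (∀ j ∈ K ∪ w₁.2.1, (I.vars j 2 = u → I.vars j 3 ∈ Z) ∧ (I.vars j 3 = u → I.vars j 2 ∈ Z)) ∧
          (∀ w ∈ Z, ∀ j ∈ K, I.vars j 0 ≠ w ∧ I.vars j 1 ≠ w) ∧ (∀ w ∈ Z, w ∉ w₁.1) ∧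
          ∀ D ⊆ K, ∀ t : Bool, IsJoin I w₁.1 D t → (∀ j ∈ D, Dead I Z j) → (t = true → ∀ g' ∈ w₁.2.1, Dead I Z g') →
            joinValue y w₁.2.2 D t ≠ 1)) :
    ¬ Terminal I r y K w₁ w₂ := by
  haveI : Nonempty (Fin n) := ⟨p⟩
  have hfree : ∀ Z : Finset (Fin n), ∀ j ∈ K ∪ w₁.2.1, ¬ Dead I Z j →
      ∃ a, Through I a j ∧ ∀ j' ∈ K ∪ w₁.2.1, Through I a j' → j' = j := fun _ j hj _ => hpriv j hj
  -- the pattern `{p}` is admissible: `p` is no XOR variable of `K` and not read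
  have hpX : ∀ j ∈ K, I.vars j 0 ≠ p ∧ I.vars j 1 ≠ p := by
    intro j hj
    by_cases hje : j = e
    · subst hje; exact ⟨hpe.1, hpe.2.1⟩
    · have h := (hpK j hj hje).1
      exact ⟨fun h0 => h (h0 ▸ vars_mem_varSet I j 0), fun h1 => h (h1 ▸ vars_mem_varSet I j 1)⟩
  obtain ⟨z₀, hz₀, hz₀p⟩ := exists_false_of_no_dead_join_singleton hI hT hKG hC₁ hpX hpC₁.1 (fun j hj _ => hpriv j hj) hidle
  refine not_terminal_of_dirty_member hI he hslots hpe hpK hpC₁ hpG₁ hpp' hSG ⟨z₀, hz₀, by rw [hz₀p, Bool.false_and]⟩ ?_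
  intro g hg u v hv hgs
  rcases hpart g hg u v hv hgs with ⟨D, hD, t, hJ, hDu, hGu, hval⟩ | ⟨huC, huX, Z, hvZ, huZ, hZX, hZC, hnoZ⟩
  · exact Or.inl (frozen_of_block_join hI hD hJ hDu hGu hval)
  · obtain ⟨z, ⟨hz, hzv⟩, hz'⟩ := thawed_of_no_dead_join hI hT hKG hC₁ hZX hZC (hfree Z) hnoZ hvZ huZ huC huX
    refine Or.inr ⟨z, ⟨hz, ?_⟩, hz'⟩
    rcases hv with rfl | rfl
    · rw [hzv, Bool.false_and]
    · rw [hzv, Bool.and_false]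

/-- **`Γ₂` MUST TOUCH EVERY IDLE-ABLE DIRTY MEMBER — JOIN FORM.**  If no monomial of `Γ₂` passes through `p` or `p'` and the pattern `{p}` has no
dead value-`1` join (typed pure, `K ∩ G₁ = ∅`, `C₁` off the AND variables, privacy), the pair is not terminal. -/
theorem not_terminal_of_untouched_dirty_joins (hI : I.IsPure xorAndPred) (hT : Typed I) (he : e ∈ K) (hKG : Disjoint K w₁.2.1)
    (hslots : I.vars e 2 = p ∧ I.vars e 3 = p') (hpe : I.vars e 0 ≠ p ∧ I.vars e 1 ≠ p ∧ I.vars e 0 ≠ p' ∧ I.vars e 1 ≠ p')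
    (hpK : ∀ j ∈ K, j ≠ e → p ∉ varSet I j ∧ p' ∉ varSet I j) (hpC₁ : p ∉ w₁.1 ∧ p' ∉ w₁.1)
    (hpG₁ : ∀ g ∈ w₁.2.1, (I.vars g 2 ≠ p ∧ I.vars g 3 ≠ p) ∧ (I.vars g 2 ≠ p' ∧ I.vars g 3 ≠ p'))
    (hpp' : ∀ g ∈ w₂.2.1, ¬ ((I.vars g 2 = p ∧ I.vars g 3 = p') ∨ (I.vars g 2 = p' ∧ I.vars g 3 = p)))
    (hC₁ : ∀ v ∈ w₁.1, ∀ j ∈ K ∪ w₁.2.1, ¬ Through I v j)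
    (hpriv : ∀ j ∈ K ∪ w₁.2.1, ∃ a, Through I a j ∧ ∀ j' ∈ K ∪ w₁.2.1, Through I a j' → j' = j)
    (hidle : ∀ D ⊆ K, ∀ t : Bool, IsJoin I w₁.1 D t → (∀ j ∈ D, Through I p j) → (t = true → ∀ g ∈ w₁.2.1, Through I p g) →
      joinValue y w₁.2.2 D t ≠ 1)
    (huntouched : ∀ g ∈ w₂.2.1, ¬ Through I p g ∧ ¬ Through I p' g) : ¬ Terminal I r y K w₁ w₂ := by
  haveI : Nonempty (Fin n) := ⟨p⟩
  have hpX : ∀ j ∈ K, I.vars j 0 ≠ p ∧ I.vars j 1 ≠ p := by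
    intro j hj
    by_cases hje : j = e
    · subst hje; exact ⟨hpe.1, hpe.2.1⟩
    · have h := (hpK j hj hje).1
      exact ⟨fun h0 => h (h0 ▸ vars_mem_varSet I j 0), fun h1 => h (h1 ▸ vars_mem_varSet I j 1)⟩
  obtain ⟨z₀, hz₀, hz₀p⟩ := exists_false_of_no_dead_join_singleton hI hT hKG hC₁ hpX hpC₁.1 (fun j hj _ => hpriv j hj) hidle
  exact not_terminal_of_untouched_dirty hI he hslots hpe hpK hpC₁ hpG₁ hpp' huntouched ⟨z₀, hz₀, by rw [hz₀p, Bool.false_and]⟩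

end Dirty

/-! ## The shared-literal member kill in join form -/

section Shared

variable {r : ℕ} {e o : Fin m} {σ p q : Fin n}

/-- **A MEMBER WITH A SHARED LITERAL KILLS THE CERTIFICATE — JOIN FORM.**  Setting `Setup I K w₁ w₂ e o σ p q` (`e = (σ, p) ∈ K`, sibling
`o = (σ, q)`, privates `p, q`); typed, `C₁` off the AND variables of `K ∪ G₁`, privacy, simple overlaps among the monomials of `Γ₂`.  JOIN
HYPOTHESES: (idle) no join whose members — and folds, if it uses the reader — all pass through `σ` has value `1` (`σ` unpinned); (partners) every
`Γ₂`-gate partner `u ∉ {σ, p, q}` of `σ, p, q` carries EITHER a one-block value-`1` join through `u` inside `K ∖ e` OR (`u ∉ C₁`, `u` no XOR variable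
of `K`) a pattern `Z ∋ σ` containing every `K ∪ G₁`-partner of `u`, off the XOR slots of `K` and off `C₁`, with no dead join of value `1`.  Then
`(K; Γ₁, Γ₂)` is not terminal. -/
theorem not_terminal_of_shared_member_joins (H : Setup I K w₁ w₂ e o σ p q) (hT : Typed I)
    (hSG : ∀ g ∈ w₂.2.1, ∀ g' ∈ w₂.2.1, g' ≠ g → ¬ ((I.vars g' 2 = I.vars g 2 ∧ I.vars g' 3 = I.vars g 3) ∨
      (I.vars g' 2 = I.vars g 3 ∧ I.vars g' 3 = I.vars g 2)))
    (hC₁ : ∀ v ∈ w₁.1, ∀ j ∈ K ∪ w₁.2.1, ¬ Through I v j)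
    (hpriv : ∀ j ∈ K ∪ w₁.2.1, ∃ a, Through I a j ∧ ∀ j' ∈ K ∪ w₁.2.1, Through I a j' → j' = j)
    (hidle : ∀ D ⊆ K, ∀ t : Bool, IsJoin I w₁.1 D t → (∀ j ∈ D, Through I σ j) → (t = true → ∀ g ∈ w₁.2.1, Through I σ g) →
      joinValue y w₁.2.2 D t ≠ 1)
    (hpart : ∀ g ∈ w₂.2.1, ∀ u v : Fin n, (v = p ∨ v = q ∨ v = σ) → ((I.vars g 2 = v ∧ I.vars g 3 = u) ∨ (I.vars g 2 = u ∧ I.vars g 3 = v)) →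
      u ≠ p → u ≠ q → u ≠ σ →
      (∃ D ⊆ K.erase e, ∃ t : Bool, IsJoin I w₁.1 D t ∧ (∀ j ∈ D, Through I u j) ∧ (t = true → ∀ g' ∈ w₁.2.1, Through I u g') ∧
          joinValue y w₁.2.2 D t = 1) ∨
      (u ∉ w₁.1 ∧ (∀ j ∈ K, I.vars j 0 ≠ u ∧ I.vars j 1 ≠ u) ∧
        ∃ Z : Finset (Fin n), σ ∈ Z ∧ (∀ j ∈ K ∪ w₁.2.1, (I.vars j 2 = u → I.vars j 3 ∈ Z) ∧ (I.vars j 3 = u → I.vars j 2 ∈ Z)) ∧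
          (∀ w ∈ Z, ∀ j ∈ K, I.vars j 0 ≠ w ∧ I.vars j 1 ≠ w) ∧ (∀ w ∈ Z, w ∉ w₁.1) ∧
          ∀ D ⊆ K, ∀ t : Bool, IsJoin I w₁.1 D t → (∀ j ∈ D, Dead I Z j) → (t = true → ∀ g' ∈ w₁.2.1, Dead I Z g') →
            joinValue y w₁.2.2 D t ≠ 1)) :
    ¬ Terminal I r y K w₁ w₂ := by
  haveI : Nonempty (Fin n) := ⟨σ⟩
  have hfree : ∀ Z : Finset (Fin n), ∀ j ∈ K ∪ w₁.2.1, ¬ Dead I Z j →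
      ∃ a, Through I a j ∧ ∀ j' ∈ K ∪ w₁.2.1, Through I a j' → j' = j := fun _ j hj _ => hpriv j hj
  have hσX : ∀ j ∈ K, I.vars j 0 ≠ σ ∧ I.vars j 1 ≠ σ := fun j hj => ⟨(H.hX j hj).1, (H.hX j hj).2.1⟩
  obtain ⟨z₁, hz₁, hz₁σ⟩ := exists_false_of_no_dead_join_singleton H.pure hT H.hKG hC₁ hσX H.hC₁.1 (fun j hj _ => hpriv j hj) hidle
  refine not_terminal_of_shared_member H hSG ⟨z₁, hz₁, hz₁σ⟩ ?_
  intro g hg u v hv hgs hup huq huσ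
  rcases hpart g hg u v hv hgs hup huq huσ with ⟨D, hD, t, hJ, hDu, hGu, hval⟩ | ⟨huC, huX, Z, hσZ, huZ, hZX, hZC, hnoZ⟩
  · exact Or.inl (frozen_of_block_join H.pure hD hJ hDu hGu hval)
  · exact Or.inr (thawed_of_no_dead_join H.pure hT H.hKG hC₁ hZX hZC (hfree Z) hnoZ hσZ huZ huC huX)

/-- **`Γ₂` MUST TOUCH THE BLOCK OF EVERY UNPINNED `N`-MEMBER — JOIN FORM.**  If no monomial of `Γ₂` passes through `σ`, `p` or `q` and the pattern
`{σ}` has no dead value-`1` join (typed, `C₁` off the AND variables, privacy), the pair is not terminal. -/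
theorem not_terminal_of_untouched_shared_joins (H : Setup I K w₁ w₂ e o σ p q) (hT : Typed I)
    (hC₁ : ∀ v ∈ w₁.1, ∀ j ∈ K ∪ w₁.2.1, ¬ Through I v j)
    (hpriv : ∀ j ∈ K ∪ w₁.2.1, ∃ a, Through I a j ∧ ∀ j' ∈ K ∪ w₁.2.1, Through I a j' → j' = j)
    (hidle : ∀ D ⊆ K, ∀ t : Bool, IsJoin I w₁.1 D t → (∀ j ∈ D, Through I σ j) → (t = true → ∀ g ∈ w₁.2.1, Through I σ g) →
      joinValue y w₁.2.2 D t ≠ 1)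
    (huntouched : ∀ g ∈ w₂.2.1, ¬ Through I σ g ∧ ¬ Through I p g ∧ ¬ Through I q g) : ¬ Terminal I r y K w₁ w₂ := by
  haveI : Nonempty (Fin n) := ⟨σ⟩
  have hσX : ∀ j ∈ K, I.vars j 0 ≠ σ ∧ I.vars j 1 ≠ σ := fun j hj => ⟨(H.hX j hj).1, (H.hX j hj).2.1⟩
  obtain ⟨z₁, hz₁, hz₁σ⟩ := exists_false_of_no_dead_join_singleton H.pure hT H.hKG hC₁ hσX H.hC₁.1 (fun j hj _ => hpriv j hj) hidle
  exact not_terminal_of_untouched_shared H huntouched ⟨z₁, hz₁, hz₁σ⟩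

end Shared

end Summit.PneNP.PneNP.Theorems.PstarMemberKillJoins
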